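import Summits.MatrixMultiplication.OmegaCensus.SmallFormats.InvertiblePointLineColumns
import HarnessLib

/-!
# ω-census family (a): line-column NO-GO one term beyond `not_lineColumnShape_one`

Cell `pub-omega` (unit `pub-omega-tensor-g27`), topic `Summits/MatrixMultiplication/OmegaCensus` (sub-folder
`SmallFormats`). Framing (verbatim): lottery ticket; floor = certified bounds/negative ranges. HONEST FRAMING: an
elementary structural lemma over an arbitrary field, continuing `InvertiblePointLineColumns` (p471507, tensor g24). It
extends `not_lineColumnShape_one` (no line-column shape `J` at a saturated invertible point when `|ι| ≤ 2n + 2|J|`) by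
ONE term — `|ι| ≤ 2n + 2|J| + 1` — whenever there are at least two free columns (`|J| + 2 ≤ n`). For the `𝔽₃`
`⟨2,2,5⟩ @ 17` census of tensor g27 (`|Z| = 7 = 2·3 + 1`) it deletes the one Kronecker-type family of the `(7,5)`
footprint filter that the δ-engine (`InvertiblePointBlockFootprint`) leaves undecided, `LT1+LT1+J1(a)+J1(b)+J1(c)`,
for every eigenvalue pattern and every orbit (desk note `LINECOL-PLUS-ONE.md`). No search, no orbit data; not a rank
bound by itself, nothing on `ω`. The bound is sharp: the real `⟨2,2,4⟩ @ 14` scheme has `|J| = 2 = n − 2` shapes at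
`|Z| = 6 = 2|J| + 2`.

**Setting** (as in the parent file, saturated point moved to `X₀ = 1`): `O` = the `2n` terms with `f_i(1) ≠ 0`,
`K₀` = the common kernel of the `g_t`, `t ∉ O` (`dim K₀ ≥ 2n − |Z|`), `M₀` = matrices supported on the free columns
(`K₀ ⊆ M₀` by `lineCol_eq_zero_of_forall_g_eq_zero`). With `|Z| ≤ 2|J| + 1`, `K₀` has codimension `≤ 1` in `M₀`.

**Proof.** (A) `K₀` contains no column-type plane `{x ⊗ v : x ∈ k²}`, `v ≠ 0` (the multiplicativity
contradiction of the parent proof). (H) any two vectors of `M₀` have a non-trivial combination in `K₀`. (B) frame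
transport on `W = x ⊗ v ∈ K₀`: either `g_s` kills `k² ⊗ v` or `f_s` kills `{X : Xx = 0}`. (C) no `f_s` kills two
such annihilators for independent `x, x'` (they span `M₂`, `f_s(1) ≠ 0`). MAIN: for free unit columns `v₁, v₂` and
`v₃ = v₁ + v₂`, (H) gives `x_i ≠ 0` with `x_i ⊗ v_i ∈ K₀`; two parallel `x_i` give `x ⊗ v₁, x ⊗ v₂ ∈ K₀` and then,
by (H) again, a column-type plane in `K₀` — contradicting (A); pairwise independent `x_i` force via (B)+(C) every
`g_s`, `s ∈ O`, to kill `e₀ ⊗ v₁`, so `e₀ ⊗ v₁ = 0` by the frame expansion — absurd.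
-/

namespace Summit.MatrixMultiplication.OmegaCensus.SmallFormats

open Module Matrix Literature.Computability.AlgebraicComplexity

variable {k : Type*} [Field k] {n : ℕ} {ι : Type*} [Fintype ι] [DecidableEq ι]

/-- **Hyperplane lemma.** If `K ≤ M` are subspaces with `dim M ≤ dim K + 1`, any two vectors of `M` have a
non-trivial linear combination in `K`. -/
theorem exists_comb_mem_of_finrank_le_succ {V : Type*} [AddCommGroup V] [Module k V] [FiniteDimensional k V]
    (K M : Submodule k V) (hle : K ≤ M) (hdim : finrank k M ≤ finrank k K + 1) {p₁ p₂ : V}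
    (hp₁ : p₁ ∈ M) (hp₂ : p₂ ∈ M) : ∃ a b : k, (a ≠ 0 ∨ b ≠ 0) ∧ a • p₁ + b • p₂ ∈ K := by
  by_cases h1 : p₁ ∈ K
  · exact ⟨1, 0, Or.inl one_ne_zero, by rwa [one_smul, zero_smul, add_zero]⟩
  · set K' := K ⊔ Submodule.span k {p₁} with hK'
    have hK'le : K' ≤ M := sup_le hle ((Submodule.span_singleton_le_iff_mem _ _).mpr hp₁)
    have hlt : K < K' := by
      refine lt_of_le_of_ne le_sup_left fun h => h1 ?_
      rw [h]; exact Submodule.mem_sup_right (Submodule.mem_span_singleton_self p₁)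
    have hfin : finrank k K < finrank k K' := Submodule.finrank_lt_finrank_of_lt hlt
    have hKM : K' = M := Submodule.eq_of_le_of_finrank_le hK'le (by omega)
    have hp₂' : p₂ ∈ K' := hKM ▸ hp₂
    obtain ⟨y, hy, z, hz, hyz⟩ := Submodule.mem_sup.mp hp₂'
    obtain ⟨c, rfl⟩ := Submodule.mem_span_singleton.mp hz
    refine ⟨-c, 1, Or.inr one_ne_zero, ?_⟩
    have : -c • p₁ + (1 : k) • p₂ = y := by rw [← hyz]; module
    rw [this]; exact hy

/-- **Two annihilators span `M₂`.** No linear functional `f` on `M₂(k)` with `f(1) ≠ 0` vanishes on both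
`{X : Xx = 0}` and `{X : Xx' = 0}` for linearly independent `x, x'` (`1 = X₁ + X₂` with `X₁x = 0`, `X₂x' = 0`). -/
theorem not_f_vanish_two_annihilators (f : Module.Dual k (Matrix (Fin 2) (Fin 2) k)) (hf : f 1 ≠ 0)
    {x x' : Fin 2 → k} (hd : x 0 * x' 1 - x 1 * x' 0 ≠ 0)
    (h : ∀ X : Matrix (Fin 2) (Fin 2) k, X *ᵥ x = 0 → f X = 0)
    (h' : ∀ X : Matrix (Fin 2) (Fin 2) k, X *ᵥ x' = 0 → f X = 0) : False := by
  set d := x 0 * x' 1 - x 1 * x' 0 with hd'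
  -- `X₁ = x' wᵀ` with `w = d⁻¹ (−x₁, x₀)`: `X₁ x = 0`, `X₁ x' = x'`
  set w : Fin 2 → k := fun l => d⁻¹ * ![-(x 1), x 0] l with hw
  set X₁ : Matrix (Fin 2) (Fin 2) k := vecMulVec x' w with hX₁
  have hwx : w ⬝ᵥ x = 0 := by
    simp only [hw, dotProduct, Fin.sum_univ_two, Matrix.cons_val_zero, Matrix.cons_val_one]; ring
  have hwx' : w ⬝ᵥ x' = 1 := by
    simp only [hw, dotProduct, Fin.sum_univ_two, Matrix.cons_val_zero, Matrix.cons_val_one]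
    field_simp
    ring
  have h1 : X₁ *ᵥ x = 0 := by
    funext i
    simp only [hX₁, mulVec, Pi.zero_apply]
    change (fun j => vecMulVec x' w i j) ⬝ᵥ x = 0
    simp only [vecMulVec_apply]
    have : (fun j => x' i * w j) ⬝ᵥ x = x' i * (w ⬝ᵥ x) := by
      simp only [dotProduct, Fin.sum_univ_two]; ring
    rw [this, hwx, mul_zero]
  have h2 : (1 - X₁) *ᵥ x' = 0 := by
    rw [Matrix.sub_mulVec, Matrix.one_mulVec]
    funext i
    simp only [hX₁, Pi.sub_apply, mulVec, Pi.zero_apply]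
    change x' i - (fun j => vecMulVec x' w i j) ⬝ᵥ x' = 0
    simp only [vecMulVec_apply]
    have : (fun j => x' i * w j) ⬝ᵥ x' = x' i * (w ⬝ᵥ x') := by
      simp only [dotProduct, Fin.sum_univ_two]; ring
    rw [this, hwx', mul_one, sub_self]
  apply hf
  have : (1 : Matrix (Fin 2) (Fin 2) k) = X₁ + (1 - X₁) := by abel
  rw [this, map_add, h X₁ h1, h' (1 - X₁) h2, add_zero]

section Shape

variable (β : BilinComp (mulBilin k 2 2 n) ι) (O : Finset ι)

/-- **(A) No column-type plane in `K₀`.** At a saturated `X₀ = 1`, if for some `v ≠ 0` every `x ⊗ v` (`x ∈ k²`)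
is killed by all `g_t`, `t ∉ O`, we get the multiplicativity contradiction `f_s(AB) f_s(1) = f_s(A) f_s(B)`. -/
theorem no_columnPlane_of_forall_g_eq_zero (hO : ∀ i, i ∉ O → β.f i 1 = 0) (hO' : ∀ i ∈ O, β.f i 1 ≠ 0)
    (hcard : O.card = 2 * n) {v : Fin n → k} (hv : v ≠ 0)
    (hK : ∀ x : Fin 2 → k, ∀ t, t ∉ O → β.g t (vecMulVec x v) = 0) : False := by
  classical
  set W₁ : Matrix (Fin 2) (Fin n) k := vecMulVec (Pi.single 0 1) v with hW₁
  have hg₁ : ∀ t, t ∉ O → β.g t W₁ = 0 := hK _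
  -- some `s ∈ O` sees `W₁ ≠ 0`
  have hW₁ne : W₁ ≠ 0 := fun h => by
    obtain ⟨j, hj⟩ := Function.ne_iff.mp hv
    have := congr_fun (congr_fun h 0) j
    rw [hW₁, vecMulVec_apply, Pi.single_eq_same, one_mul, Matrix.zero_apply] at this
    exact hj this
  have hex : ∃ s ∈ O, β.g s W₁ ≠ 0 := by
    by_contra hall
    push Not at hall
    have h := mul_eq_sum_off β 1 O hO W₁
    rw [Matrix.one_mul] at h
    apply hW₁ne
    rw [h]; exact Finset.sum_eq_zero fun s hs => by rw [hall s hs, mul_zero, zero_smul]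
  obtain ⟨s, hs, hgs⟩ := hex
  refine not_mul_hom_matrix_two (β.f s) (hO' s hs) rfl fun A B => ?_
  have hBW : ∀ t, t ∉ O → β.g t (B * W₁) = 0 := by
    rw [hW₁, mul_vecMulVec]; exact hK _
  have h1 := f_one_mul_g_mul β O hO hcard hg₁ hs (A * B)
  have h2 := f_one_mul_g_mul β O hO hcard hBW hs A
  have h3 := f_one_mul_g_mul β O hO hcard hg₁ hs B
  rw [Matrix.mul_assoc] at h1
  have key : β.f s (A * B) * β.f s 1 * β.g s W₁ = β.f s A * β.f s B * β.g s W₁ := by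
    have e1 : β.f s 1 * (β.f s 1 * β.g s (A * (B * W₁))) = β.f s 1 * (β.f s (A * B) * β.g s W₁) := by rw [h1]
    have e2 : β.f s 1 * (β.f s 1 * β.g s (A * (B * W₁))) = β.f s A * (β.f s 1 * β.g s (B * W₁)) := by
      rw [h2]; ring
    rw [h3] at e2
    linear_combination -e1 + e2
  exact mul_right_cancel₀ hgs key

/-- **(B) Dichotomy.** If `x ≠ 0` and `x ⊗ v` is killed by every `g_t`, `t ∉ O`, then for each `s ∈ O`: either
`g_s` kills the whole plane `k² ⊗ v`, or `f_s` vanishes on every `X` with `Xx = 0`. (Frame transport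
`f_s(1) g_s((Xx) ⊗ v) = f_s(X) g_s(x ⊗ v)`, and `Xx` ranges over `k²`.) -/
theorem g_vanish_or_f_vanish (hO : ∀ i, i ∉ O → β.f i 1 = 0) (hO' : ∀ i ∈ O, β.f i 1 ≠ 0)
    (hcard : O.card = 2 * n) {x : Fin 2 → k} (hx : x ≠ 0) {v : Fin n → k}
    (hK : ∀ t, t ∉ O → β.g t (vecMulVec x v) = 0) {s : ι} (hs : s ∈ O) :
    (∀ y : Fin 2 → k, β.g s (vecMulVec y v) = 0) ∨
      (∀ X : Matrix (Fin 2) (Fin 2) k, X *ᵥ x = 0 → β.f s X = 0) := by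
  have key : ∀ X : Matrix (Fin 2) (Fin 2) k,
      β.f s 1 * β.g s (vecMulVec (X *ᵥ x) v) = β.f s X * β.g s (vecMulVec x v) := fun X => by
    rw [← mul_vecMulVec]; exact f_one_mul_g_mul β O hO hcard hK hs X
  by_cases h0 : β.g s (vecMulVec x v) = 0
  · left
    intro y
    obtain ⟨i, hi⟩ := Function.ne_iff.mp hx
    -- `X = y ⊗ (x_i⁻¹ e_i)` has `X x = y`
    set X : Matrix (Fin 2) (Fin 2) k := vecMulVec y (Pi.single i (x i)⁻¹) with hX
    have hXx : X *ᵥ x = y := by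
      rw [hX, vecMulVec_mulVec, single_dotProduct, inv_mul_cancel₀ hi, MulOpposite.op_one, one_smul]
    have := key X
    rw [hXx, h0, mul_zero] at this
    rcases mul_eq_zero.mp this with h | h
    · exact absurd h (hO' s hs)
    · exact h
  · right
    intro X hXx
    have := key X
    rw [hXx, zero_vecMulVec, map_zero, mul_zero] at this
    rcases mul_eq_zero.mp this.symm with h | h
    · exact h
    · exact absurd h h0

end Shape

/-- Two nonzero vectors of `k²` with vanishing determinant are proportional (with a nonzero factor). -/
theorem exists_smul_of_det_eq_zero {x y : Fin 2 → k} (hx : x ≠ 0) (hy : y ≠ 0)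
    (hd : x 0 * y 1 - x 1 * y 0 = 0) : ∃ c : k, c ≠ 0 ∧ y = c • x := by
  by_cases h0 : x 0 = 0
  · have h1 : x 1 ≠ 0 := fun h1 => hx (by funext r; fin_cases r; exacts [h0, h1])
    have hy0 : y 0 = 0 := by
      rw [h0, zero_mul, zero_sub, neg_eq_zero] at hd
      exact (mul_eq_zero.mp hd).resolve_left h1
    have hy1 : y 1 ≠ 0 := fun hy1 => hy (by funext r; fin_cases r; exacts [hy0, hy1])
    refine ⟨y 1 / x 1, div_ne_zero hy1 h1, ?_⟩
    funext r; fin_cases r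
    · simp [h0, hy0]
    · simp only [Fin.mk_one, Fin.isValue, Pi.smul_apply, smul_eq_mul]; field_simp
  · refine ⟨y 0 / x 0, fun hc => ?_, ?_⟩
    · have hy0 : y 0 = 0 := by
        rcases div_eq_zero_iff.mp hc with h | h
        · exact h
        · exact absurd h h0
      have hy1 : y 1 = 0 := by
        rw [hy0, mul_zero, sub_zero] at hd
        exact (mul_eq_zero.mp hd).resolve_left h0
      exact hy (by funext r; fin_cases r; exacts [hy0, hy1])
    · funext r; fin_cases r
      · simp only [Fin.zero_eta, Fin.isValue, Pi.smul_apply, smul_eq_mul]; field_simp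
      · simp only [Fin.mk_one, Fin.isValue, Pi.smul_apply, smul_eq_mul]; field_simp; linear_combination hd

/-- Every `y ∈ k²` is `y₀ e₀ + y₁ e₁`. -/
theorem eq_single_add_single (y : Fin 2 → k) :
    y = y 0 • (Pi.single 0 1 : Fin 2 → k) + y 1 • (Pi.single 1 1 : Fin 2 → k) := by
  funext r; fin_cases r <;> simp

/-- **NO-GO for line-column shapes at a saturated point, one term beyond `not_lineColumnShape_one`.** Let `β`
compute `X ↦ XY` on `k^{2×2} × k^{2×n}` with the invertible-point cap attained at `1` (`|O| = 2n`, `O` = the terms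
not vanishing at `1`). If `J` is a set of at most `n − 2` columns with nonzero directions `ζ_j` and the number of
terms is at most `2n + 2|J| + 1`, then it is NOT the case that every output `W_t` of a term vanishing at `1` has its
`j`-th column on the line `k·ζ_j` for all `j ∈ J`. For `n = 5`, `|ι| = 17`, `|J| = 3` this excludes the Kronecker
types `LT1+LT1+J1(a)+J1(b)+J1(c)` (all `a, b, c ∈ k ∪ {∞}`) as superspaces of `span{W_t : t ∈ Z}` — the residual
family of the tensor-g27 `(5,17)` δ-census (`LINECOL-PLUS-ONE.md`). -/
theorem not_lineColumnShape_succ (β : BilinComp (mulBilin k 2 2 n) ι) (O : Finset ι)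
    (hO : ∀ i, i ∉ O → β.f i 1 = 0) (hO' : ∀ i ∈ O, β.f i 1 ≠ 0) (hcard : O.card = 2 * n)
    (J : Finset (Fin n)) (ζ : Fin n → Fin 2 → k) (hζ : ∀ j ∈ J, ζ j ≠ 0) (hJ : J.card + 2 ≤ n)
    (hZ : Fintype.card ι ≤ 2 * n + 2 * J.card + 1) :
    ¬ ∀ t, t ∉ O → ∀ j ∈ J, ∃ c : k, ∀ r, β.w t r j = c * ζ j r := by
  classical
  intro hT
  have hTj : ∀ j ∈ J, ∀ t, t ∉ O → ∃ c : k, ∀ r, β.w t r j = c * ζ j r := fun j hj t ht => hT t ht j hj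
  -- `K₀` = common kernel of the `g_t`, `t ∉ O`; `M₀` = span of the unit matrices in the free columns
  set Zs : Finset ι := Finset.univ \ O with hZs
  let φ : Matrix (Fin 2) (Fin n) k →ₗ[k] (Zs → k) := LinearMap.pi fun t => β.g (t : ι)
  set K₀ := LinearMap.ker φ with hK₀
  have memK₀ : ∀ W, W ∈ K₀ ↔ ∀ t, t ∉ O → β.g t W = 0 := fun W => by
    rw [hK₀, LinearMap.mem_ker]
    constructor
    · intro h t ht
      have := congr_fun h ⟨t, Finset.mem_sdiff.mpr ⟨Finset.mem_univ t, ht⟩⟩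
      simpa [φ] using this
    · intro h; funext t; simpa [φ] using h t (Finset.mem_sdiff.mp t.2).2
  set Js : Finset (Fin n) := Finset.univ \ J with hJs
  let b : Fin 2 × Js → Matrix (Fin 2) (Fin n) k := fun p => single p.1 (p.2 : Fin n) (1 : k)
  set M₀ := Submodule.span k (Set.range b) with hM₀
  have memM₀ : ∀ W : Matrix (Fin 2) (Fin n) k, (∀ j ∈ J, ∀ i, W i j = 0) → W ∈ M₀ := by
    intro W hW
    rw [matrix_eq_sum_single W]
    refine Submodule.sum_mem _ fun i _ => Submodule.sum_mem _ fun j _ => ?_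
    by_cases hj : j ∈ J
    · rw [hW j hj i, single_zero]; exact Submodule.zero_mem _
    · have : single i j (W i j) = W i j • b (i, ⟨j, Finset.mem_sdiff.mpr ⟨Finset.mem_univ j, hj⟩⟩) := by
        simp only [b, smul_single, smul_eq_mul, mul_one]
      rw [this]
      exact Submodule.smul_mem _ _ (Submodule.subset_span ⟨_, rfl⟩)
  have hle : K₀ ≤ M₀ := fun W hW =>
    memM₀ W fun j hj i => lineCol_eq_zero_of_forall_g_eq_zero β O hO hO' hcard (hζ j hj) (hTj j hj)
      ((memK₀ W).mp hW) i
  -- dimensions: `dim M₀ ≤ 2(n − |J|) ≤ 2n − |Z| + 1 ≤ dim K₀ + 1`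
  have hdimM : finrank k M₀ ≤ 2 * (n - J.card) := by
    calc finrank k M₀ ≤ Fintype.card (Fin 2 × Js) := finrank_range_le_card b
      _ = 2 * (n - J.card) := by
          rw [Fintype.card_prod, Fintype.card_fin, Fintype.card_coe, hJs, Finset.card_sdiff,
            Finset.inter_univ, Finset.card_univ, Fintype.card_fin]
  have hdimK : 2 * n ≤ finrank k K₀ + (Fintype.card ι - O.card) := by
    have h1 := LinearMap.finrank_range_add_finrank_ker φ
    rw [finrank_matrix_fin, ← hK₀] at h1
    have h2 : finrank k (LinearMap.range φ) ≤ Fintype.card ι - O.card := by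
      calc finrank k (LinearMap.range φ) ≤ finrank k (Zs → k) := Submodule.finrank_le _
        _ = Fintype.card ι - O.card := by
            rw [finrank_fintype_fun_eq_card, Fintype.card_coe, hZs, Finset.card_sdiff, Finset.inter_univ,
              Finset.card_univ]
    omega
  have hcodim : finrank k M₀ ≤ finrank k K₀ + 1 := by omega
  -- two free columns `j₁ ≠ j₂`
  have hJs2 : 1 < Js.card := by
    rw [hJs, Finset.card_sdiff, Finset.inter_univ, Finset.card_univ, Fintype.card_fin]; omega
  obtain ⟨j₁, hj₁, j₂, hj₂, hne⟩ := Finset.one_lt_card.mp hJs2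
  have hj₁J : j₁ ∉ J := (Finset.mem_sdiff.mp hj₁).2; have hj₂J : j₂ ∉ J := (Finset.mem_sdiff.mp hj₂).2
  -- free directions `vv a b = a e_{j₁} + b e_{j₂}`
  let vv : k → k → (Fin n → k) := fun a c => a • Pi.single j₁ 1 + c • Pi.single j₂ 1
  have hvJ : ∀ a c, ∀ j ∈ J, vv a c j = 0 := by
    intro a c j hj
    have h1 : j ≠ j₁ := fun h => hj₁J (h ▸ hj); have h2 : j ≠ j₂ := fun h => hj₂J (h ▸ hj)
    simp [vv, Pi.single_eq_of_ne h1, Pi.single_eq_of_ne h2]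
  have hv1 : ∀ a c, vv a c j₁ = a := fun a c => by simp [vv, Pi.single_eq_of_ne hne]
  have hv2 : ∀ a c, vv a c j₂ = c := fun a c => by simp [vv, Pi.single_eq_of_ne hne.symm]
  have hvne : ∀ a c, (a ≠ 0 ∨ c ≠ 0) → vv a c ≠ 0 := by
    intro a c hac h
    have e1 := congr_fun h j₁; have e2 := congr_fun h j₂
    rw [hv1, Pi.zero_apply] at e1; rw [hv2, Pi.zero_apply] at e2
    rcases hac with ha | hc; exacts [ha e1, hc e2]
  have hv3 : vv 1 1 = vv 1 0 + vv 0 1 := by simp [vv]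
  have hvM : ∀ (x : Fin 2 → k) (a c : k), vecMulVec x (vv a c) ∈ M₀ := fun x a c =>
    memM₀ _ fun j hj i => by rw [vecMulVec_apply, hvJ a c j hj, mul_zero]
  -- (H): for every free direction some `x ≠ 0` has `x ⊗ v ∈ K₀`
  have hH : ∀ a c, ∃ x : Fin 2 → k, x ≠ 0 ∧ vecMulVec x (vv a c) ∈ K₀ := by
    intro a c
    obtain ⟨p, q, hpq, hmem⟩ := exists_comb_mem_of_finrank_le_succ K₀ M₀ hle hcodim
      (hvM (Pi.single 0 1) a c) (hvM (Pi.single 1 1) a c)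
    refine ⟨p • Pi.single 0 1 + q • Pi.single 1 1, fun h => ?_, ?_⟩
    · have e0 := congr_fun h 0; have e1 := congr_fun h 1
      simp at e0 e1
      rcases hpq with hp | hq
      exacts [hp e0, hq e1]
    · rwa [add_vecMulVec, smul_vecMulVec, smul_vecMulVec]
  -- a column-type plane `k² ⊗ v` in `K₀` is impossible (A)
  have plane : ∀ a c, (a ≠ 0 ∨ c ≠ 0) → vecMulVec (Pi.single 0 1) (vv a c) ∈ K₀ →
      vecMulVec (Pi.single 1 1) (vv a c) ∈ K₀ → False := by
    intro a c hac h0 h1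
    refine no_columnPlane_of_forall_g_eq_zero β O hO hO' hcard (hvne a c hac) fun y t ht => ?_
    have hy : vecMulVec y (vv a c) ∈ K₀ := by
      rw [eq_single_add_single y, add_vecMulVec, smul_vecMulVec, smul_vecMulVec]
      exact add_mem (K₀.smul_mem _ h0) (K₀.smul_mem _ h1)
    exact (memK₀ _).mp hy t ht
  -- (D): `x ≠ 0` with `x ⊗ e_{j₁}, x ⊗ e_{j₂} ∈ K₀` is impossible
  have hD : ∀ x : Fin 2 → k, x ≠ 0 → vecMulVec x (vv 1 0) ∈ K₀ → vecMulVec x (vv 0 1) ∈ K₀ → False := by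
    intro x hx h10 h01
    have hxv : ∀ a c, vecMulVec x (vv a c) ∈ K₀ := fun a c => by
      have : vv a c = a • vv 1 0 + c • vv 0 1 := by simp [vv]
      rw [this, vecMulVec_add, vecMulVec_smul, vecMulVec_smul]
      exact add_mem (K₀.smul_mem _ h10) (K₀.smul_mem _ h01)
    by_cases hx1 : x 1 = 0
    · have hx0 : x 0 ≠ 0 := fun hx0 => hx (by funext r; fin_cases r; exacts [hx0, hx1])
      -- `e₀ = x₀⁻¹ x`, so `e₀ ⊗ v ∈ K₀` for every free `v`; (H) on `e₁ ⊗ e_{j₁}, e₁ ⊗ e_{j₂}`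
      have he0 : (Pi.single 0 1 : Fin 2 → k) = (x 0)⁻¹ • x := by
        funext r; fin_cases r
        · simp [inv_mul_cancel₀ hx0]
        · simp [hx1]
      have h0 : ∀ a c, vecMulVec (Pi.single 0 1) (vv a c) ∈ K₀ := fun a c => by
        rw [he0, smul_vecMulVec]; exact K₀.smul_mem _ (hxv a c)
      obtain ⟨p, q, hpq, hmem⟩ := exists_comb_mem_of_finrank_le_succ K₀ M₀ hle hcodim
        (hvM (Pi.single 1 1) 1 0) (hvM (Pi.single 1 1) 0 1)
      have h1 : vecMulVec (Pi.single 1 1) (vv p q) ∈ K₀ := by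
        have : vv p q = p • vv 1 0 + q • vv 0 1 := by simp [vv]
        rwa [this, vecMulVec_add, vecMulVec_smul, vecMulVec_smul]
      exact plane p q hpq (h0 p q) h1
    · -- `e₁ = x₁⁻¹ (x − x₀ e₀)`; (H) on `e₀ ⊗ e_{j₁}, e₀ ⊗ e_{j₂}`
      obtain ⟨p, q, hpq, hmem⟩ := exists_comb_mem_of_finrank_le_succ K₀ M₀ hle hcodim
        (hvM (Pi.single 0 1) 1 0) (hvM (Pi.single 0 1) 0 1)
      have h0 : vecMulVec (Pi.single 0 1) (vv p q) ∈ K₀ := by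
        have : vv p q = p • vv 1 0 + q • vv 0 1 := by simp [vv]
        rwa [this, vecMulVec_add, vecMulVec_smul, vecMulVec_smul]
      have he1 : (Pi.single 1 1 : Fin 2 → k) = (x 1)⁻¹ • (x - x 0 • (Pi.single 0 1 : Fin 2 → k)) := by
        funext r; fin_cases r
        · simp
        · simp [inv_mul_cancel₀ hx1]
      have h1 : vecMulVec (Pi.single 1 1) (vv p q) ∈ K₀ := by
        rw [he1, smul_vecMulVec, sub_vecMulVec, smul_vecMulVec]
        exact K₀.smul_mem _ (sub_mem (hxv p q) (K₀.smul_mem _ h0))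
      exact plane p q hpq h0 h1
  -- the three free directions `e_{j₁}`, `e_{j₂}`, `e_{j₁} + e_{j₂}`
  obtain ⟨x₁, hx₁, hK₁⟩ := hH 1 0
  obtain ⟨x₂, hx₂, hK₂⟩ := hH 0 1
  obtain ⟨x₃, hx₃, hK₃⟩ := hH 1 1
  by_cases d12 : x₁ 0 * x₂ 1 - x₁ 1 * x₂ 0 = 0
  · obtain ⟨c, hc, hx⟩ := exists_smul_of_det_eq_zero hx₁ hx₂ d12
    rw [hx, smul_vecMulVec] at hK₂
    exact hD x₁ hx₁ hK₁ ((K₀.smul_mem_iff hc).mp hK₂)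
  by_cases d13 : x₁ 0 * x₃ 1 - x₁ 1 * x₃ 0 = 0
  · obtain ⟨c, hc, hx⟩ := exists_smul_of_det_eq_zero hx₁ hx₃ d13
    rw [hx, smul_vecMulVec] at hK₃
    have h3 : vecMulVec x₁ (vv 1 1) ∈ K₀ := (K₀.smul_mem_iff hc).mp hK₃
    have h2 : vecMulVec x₁ (vv 0 1) ∈ K₀ := by
      have : vecMulVec x₁ (vv 0 1) = vecMulVec x₁ (vv 1 1) - vecMulVec x₁ (vv 1 0) := by
        rw [← vecMulVec_sub, hv3, add_sub_cancel_left]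
      rw [this]; exact sub_mem h3 hK₁
    exact hD x₁ hx₁ hK₁ h2
  by_cases d23 : x₂ 0 * x₃ 1 - x₂ 1 * x₃ 0 = 0
  · obtain ⟨c, hc, hx⟩ := exists_smul_of_det_eq_zero hx₂ hx₃ d23
    rw [hx, smul_vecMulVec] at hK₃
    have h3 : vecMulVec x₂ (vv 1 1) ∈ K₀ := (K₀.smul_mem_iff hc).mp hK₃
    have h1 : vecMulVec x₂ (vv 1 0) ∈ K₀ := by
      have : vecMulVec x₂ (vv 1 0) = vecMulVec x₂ (vv 1 1) - vecMulVec x₂ (vv 0 1) := by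
        rw [← vecMulVec_sub, hv3, add_sub_cancel_right]
      rw [this]; exact sub_mem h3 hK₂
    exact hD x₂ hx₂ h1 hK₂
  -- generic case: `x₁, x₂, x₃` pairwise independent ⇒ every `g_s`, `s ∈ O`, kills `e₀ ⊗ e_{j₁}`
  have hkill : ∀ s ∈ O, β.g s (vecMulVec (Pi.single 0 1) (vv 1 0)) = 0 := by
    intro s hs
    have lin : ∀ y : Fin 2 → k, β.g s (vecMulVec y (vv 1 1)) =
        β.g s (vecMulVec y (vv 1 0)) + β.g s (vecMulVec y (vv 0 1)) := fun y => by
      rw [hv3, vecMulVec_add, map_add]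
    rcases g_vanish_or_f_vanish β O hO hO' hcard hx₁ ((memK₀ _).mp hK₁) hs with g1 | f1
    · exact g1 _
    rcases g_vanish_or_f_vanish β O hO hO' hcard hx₂ ((memK₀ _).mp hK₂) hs with g2 | f2
    · rcases g_vanish_or_f_vanish β O hO hO' hcard hx₃ ((memK₀ _).mp hK₃) hs with g3 | f3
      · have := lin (Pi.single 0 1)
        rw [g3, g2, add_zero] at this
        exact this.symm
      · exact (not_f_vanish_two_annihilators (β.f s) (hO' s hs) d13 f1 f3).elim
    · exact (not_f_vanish_two_annihilators (β.f s) (hO' s hs) d12 f1 f2).elim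
  have hzero : vecMulVec (Pi.single 0 1 : Fin 2 → k) (vv 1 0) = 0 := by
    have h := mul_eq_sum_off β 1 O hO (vecMulVec (Pi.single 0 1) (vv 1 0))
    rw [Matrix.one_mul] at h
    rw [h]
    exact Finset.sum_eq_zero fun s hs => by rw [hkill s hs, mul_zero, zero_smul]
  have := congr_fun (congr_fun hzero 0) j₁
  rw [vecMulVec_apply, Pi.single_eq_same, one_mul, hv1, Matrix.zero_apply] at this
  exact one_ne_zero this

/-- **The census instance: `⟨2,2,5⟩` with 17 terms, three line columns** (`|Z| = 7 = 2·3 + 1`, two free columns).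
At a saturated `X₀ = 1` the outputs of the seven vanishing terms do NOT all have their columns `j ∈ J` (`|J| = 3`)
on prescribed lines `k·ζ_j`: the `(7,5)` Kronecker types `LT1+LT1+J1(a)+J1(b)+J1(c)` are excluded as superspaces of
`span{W_t : t ∈ Z}`, over any field and for any eigenvalue pattern. -/
theorem not_lineColumnShape_succ_225 {ι : Type*} [Fintype ι] [DecidableEq ι]
    (β : BilinComp (mulBilin k 2 2 5) ι) (hι : Fintype.card ι = 17) (O : Finset ι)
    (hO : ∀ i, i ∉ O → β.f i 1 = 0) (hO' : ∀ i ∈ O, β.f i 1 ≠ 0) (hcard : O.card = 10)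
    (J : Finset (Fin 5)) (hJ : J.card = 3) (ζ : Fin 5 → Fin 2 → k) (hζ : ∀ j ∈ J, ζ j ≠ 0) :
    ¬ ∀ t, t ∉ O → ∀ j ∈ J, ∃ c : k, ∀ r, β.w t r j = c * ζ j r :=
  not_lineColumnShape_succ β O hO hO' hcard J ζ hζ (by omega) (by omega)

end Summit.MatrixMultiplication.OmegaCensus.SmallFormats
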